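import Summits.BirchSwinnertonDyer.Rank1Residual.X4.KuriharaLevelLoweringTwist
import Summits.BirchSwinnertonDyer.Rank1Residual.Additive.SemistableTwistAnalytic
import Literature.NumberTheory.EllipticCurves.CuspFormTwistRatPlusSymbol
import Literature.NumberTheory.EllipticCurves.ComplexMultiplicationBurungaleFlachProofs
import HarnessLib

/-!
# The level-lowering certificate of an additive curve `W = V ⊗ χ_p` (`p ≡ 1 mod 4`) from the certificate of its semistable twist `V`, the period bookkeeping DISCHARGED (cell `b2b-bsdres`, seat additive-p4, line V40; assembly of `X4/KuriharaLevelLoweringTwist` with the tree's twisted-modular-symbol theorems and Pal 2012)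

HONEST FRAMING (verbatim, cell `b2b-bsdres`): the goal of the cell is to DELETE the COMBINATION-SHAPED
residual classes for ALL analytic-rank `≤ 1` curves over `ℚ` — "full BSD formula for every rank `≤ 1`
curve in class `C`" assembled STRICTLY from published theorems — so that the rank-`≤ 1` remainder
becomes exactly the CONSTRUCTION-SHAPED classes, which are TYPED (missing-input Props), NOT attempted;
this is not "finishing BSD". This file: research-route KERNEL THEOREMS; ONE named fact enters (Pal 2012
Thm. 3.2, `hPal`, as in `Additive/SemistableTwistAnalytic`); no definition, nothing booked; class X4 stays
CONSTRUCTION-SHAPED; the `V`-side certificate is a per-pair instrument output (EVIDENCE), never a fact.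

## What is proved

`X4/KuriharaLevelLoweringTwist` (§3, `plusSymbolLevelLowersAt_of_legendreTwist`) transports the
certificate `PlusSymbolLevelLowersAt` from `V` to `W = V ⊗ χ_p` given (i) the ℚ-level twist identity
`[r]⁺_{f_W} = c₀ · ∑_u (u/p)[r + u/p]⁺_{f_V}` with (ii) a `p`-INTEGRAL constant `c₀`. Here both are
DISCHARGED for the cell's pairs at `p ≡ 1 (mod 4)`:
* §1 `charTwist_eq_of_isNewformOf`: the newform of `W` IS the twist of the newform of `V`
  (`q`-expansions: `aₙ(W) = (n/p)aₙ(V)`, gen-2 `intCast_LFunction_eq_jacobiChar_mul_cuspCoeff`, and the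
  tree's `cuspCoeff_charTwist` + `q`-expansion principle);
* §2 `exists_rat_ratPlusSymbol_eq_legendreTwistSum`: (i) from the tree theorem
  `ModularForms.exists_rat_forall_ratPlusSymbol_charTwist_eq` (Shimura 3.64 at the symbol level), with the
  period relation `c₀ · Ω⁺_{f_W} · τ(χ_p) = Ω⁺_{f_V}` in the non-degenerate case;
* §3 `norm_ratCast_eq_one_of_period_relation`: (ii) `|c₀|_p = 1` from that relation, Pal 2012 Thm. 3.2
  (`√p · Ω_W = Ω_V`, named fact `hPal`), `τ(χ_p)² = p`, and the two period transfers
  `Ω_W = u_W Ω⁺_{f_W}`, `Ω_V = u_V Ω⁺_{f_V}` with `p`-adic units `u_W, u_V` (the cell's standard Manin-type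
  binders, e.g. `periodTransfer_of_optimal`): `c₀ = ± u_W / u_V`;
* §4 `plusSymbolLevelLowersAt_of_twist_certificate`: hence `PlusSymbolLevelLowersAt W p f_W ℓ` from the
  `V`-side data alone (`μ` periodic, Hecke with `a_q(V)` at the Kolyvagin primes of `(W,p)`, the mod-`p`
  `ℓ`-old identity of sign `w` for `f_V`'s plus symbol, `w·(ℓ/p) = 1`, `p ∤ ℓ`), the `p`-integrality of
  `f_V`'s symbols, the twist relation `a_q(W) ≡ (q/p)a_q(V)` and the period data — in the degenerate case
  (all twisted sums vanish) the plus symbol of `f_W` vanishes identically and the certificate is trivial.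
All consequences of `X4/KuriharaLevelLowering` / `X4/KimDefectLevelLowering` then apply to `W` with a
certificate COMPUTED ON `V` at level `N_V/ℓ = N_W/(p²ℓ)`.

## References

* V. Pal, Canad. Math. Bull. 55 (2012), Thm. 3.2, Prop. 2.5. [cite: Pal2012, Thm. 3.2]
* G. Shimura (1971), Prop. 3.64; B. Mazur, J. Tate, J. Teitelbaum (1986), §I.8. [cite: MazurTateTeitelbaum1986Invent, §I.8]
* C.-H. Kim, Amer. J. Math. 148 (2026), §1.2.2, §1.4.3. [cite: Kim2022StructureSelmer, §1.2.2 and §1.4.3]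
-/

noncomputable section

open scoped Classical MatrixGroups ModularForm

open CongruenceSubgroup WeierstrassCurve Literature.NumberTheory.EllipticCurves
  Literature.NumberTheory.EllipticCurves.ModularForms
  Literature.NumberTheory.EllipticCurves.Rank1Residual
  Literature.NumberTheory.QuadraticFields
  Summit.BirchSwinnertonDyer.Rank1Residual.LevelLowering

namespace Summit.BirchSwinnertonDyer.Rank1Residual.Additive

variable (p : ℕ) [hp : Fact p.Prime]

/-! ### §1 The newform of `W` is the twist of the newform of `V` -/

/-- **`f_W = (f_V)_{χ_p}`** as cusp forms of level `N_W` (`N_V ∣ N_W`, `p² ∣ N_W`): both sides have the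
`q`-expansion `∑ (n/p) aₙ(V) qⁿ` (`cuspCoeff_charTwist`; gen-2 `intCast_LFunction_eq_jacobiChar_mul_cuspCoeff`),
and a cusp form on `Γ₀(N)` is determined by its `q`-expansion. [cite: Shimura1971, Prop. 3.64] -/
theorem charTwist_eq_of_isNewformOf (hp4 : p % 4 = 1) (V W : WeierstrassCurve ℚ) [V.IsElliptic]
    [W.IsElliptic] (hVW : ∃ C : VariableChange ℚ, C • V.quadraticTwist (p : ℚ) = W) (hadd : Addv W p)
    {NV NW : ℕ} [NeZero NV] [NeZero NW] {fV : CuspForm (Gamma0 NV) 2} {fW : CuspForm (Gamma0 NW) 2}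
    (hfV : IsNewformOf V fV) (hfW : IsNewformOf W fW) (hN : NV ∣ NW) (hm : p ^ 2 ∣ NW) :
    haveI : NeZero p := ⟨hp.out.ne_zero⟩
    charTwist NW hN hm (jacobiChar_prime_ne_one_isQuadratic_isPrimitive p (by omega)).2.1 fV = fW := by
  haveI : NeZero p := ⟨hp.out.ne_zero⟩
  have hprim := (jacobiChar_prime_ne_one_isQuadratic_isPrimitive p (by omega)).2.2
  refine eq_of_forall_cuspCoeff_eq_gamma0 fun n ↦ ?_
  rw [cuspCoeff_charTwist NW hN hm _ hprim fV n, hfW.2 n,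
    intCast_LFunction_eq_jacobiChar_mul_cuspCoeff p hp4 V W hVW hadd hfV n]

/-! ### §2 The ℚ-level twist identity for `(f_W, f_V)` with one constant -/

/-- **`[r]⁺_{f_W} = c₀ · ∑_{u mod p} (u/p) [r + u/p]⁺_{f_V}` with ONE `c₀ ∈ ℚ`**, and
`c₀ · Ω⁺_{f_W} · τ(χ_p) = Ω⁺_{f_V}` when some twisted sum is non-zero (tree
`exists_rat_forall_ratPlusSymbol_charTwist_eq` for the even primitive quadratic `χ_p`, `p ≡ 1 mod 4`,
and §1). [cite: MazurTateTeitelbaum1986Invent, §I.8] -/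
theorem exists_rat_ratPlusSymbol_eq_legendreTwistSum (hp4 : p % 4 = 1) (V W : WeierstrassCurve ℚ)
    [V.IsElliptic] [W.IsElliptic] (hVW : ∃ C : VariableChange ℚ, C • V.quadraticTwist (p : ℚ) = W)
    (hadd : Addv W p) {NV NW : ℕ} [NeZero NV] [NeZero NW] {fV : CuspForm (Gamma0 NV) 2}
    {fW : CuspForm (Gamma0 NW) 2} (hfV : IsNewformOf V fV) (hfW : IsNewformOf W fW) (hN : NV ∣ NW)
    (hm : p ^ 2 ∣ NW) :
    haveI : NeZero p := ⟨hp.out.ne_zero⟩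
    ∃ c₀ : ℚ, (∀ r : ℚ, ratPlusSymbol fW r =
        c₀ * ∑ u : ZMod p, (legendreSym p (u.val : ℤ) : ℚ) * ratPlusSymbol fV (r + (u.val : ℚ) / p)) ∧
      ((∃ r : ℚ, ∑ u : ZMod p, (legendreSym p (u.val : ℤ) : ℚ) * ratPlusSymbol fV (r + (u.val : ℚ) / p) ≠ 0) →
        (c₀ : ℂ) * (plusPeriod fW : ℂ) * gaussSum (jacobiChar p) (ZMod.stdAddChar (N := p)) =
          (plusPeriod fV : ℂ)) := by
  haveI : NeZero p := ⟨hp.out.ne_zero⟩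
  obtain ⟨_, hχq, hχp⟩ := jacobiChar_prime_ne_one_isQuadratic_isPrimitive p (show p ≠ 2 by omega)
  have hχe := jacobiChar_even_of_mod_four_eq_one p hp4
  have hFW := charTwist_eq_of_isNewformOf p hp4 V W hVW hadd hfV hfW hN hm
  have hε : ∀ u : ZMod p, jacobiChar p u = (((fun u : ZMod p ↦ legendreSym p (u.val : ℤ)) u : ℤ) : ℂ) := by
    intro u
    rw [jacobiChar_apply, ← jacobiSym.legendreSym.to_jacobiSym]
  have hF : IsNewform0 (charTwist NW hN hm hχq fV) := by rw [hFW]; exact hfW.1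
  have hQF : coeffField (charTwist NW hN hm hχq fV) = ⊥ := by rw [hFW]; exact hfW.coeffField_eq_bot
  obtain ⟨c, hc, hrel⟩ := exists_rat_forall_ratPlusSymbol_charTwist_eq NW hN hm hχq hχe hχp hfV.1
    hfV.coeffField_eq_bot hF hQF (fun u : ZMod p ↦ legendreSym p (u.val : ℤ)) hε
  rw [hFW] at hc hrel
  exact ⟨c, fun r ↦ by simpa only [twistShift] using hc r,
    fun ⟨r, hr⟩ ↦ hrel ⟨r, by simpa only [twistShift] using hr⟩⟩

/-! ### §3 The constant is a `p`-adic unit -/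

/-- **`|c₀|_p = 1` from the period relation.** If `c₀ · Ω⁺_{f_W} · τ = Ω⁺_{f_V}` with `τ² = p`,
`√p · Ω_W = Ω_V` (Pal 2012 Thm. 3.2 at `p ≡ 1 mod 4`), `Ω_W = u_W Ω⁺_{f_W}` and `Ω_V = u_V Ω⁺_{f_V}` with
rationals `u_W, u_V` of `p`-adic norm `1`, and `Ω_W > 0`, then `c₀ = ± u_W/u_V`, a `p`-adic unit.
[cite: Pal2012, Thm. 3.2] -/
theorem norm_ratCast_eq_one_of_period_relation {c₀ uW uV : ℚ} {ΩW ΩV ΩfW ΩfV : ℝ} {τ : ℂ}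
    (hτ : τ ^ 2 = (p : ℂ)) (hrel : (c₀ : ℂ) * (ΩfW : ℂ) * τ = (ΩfV : ℂ))
    (hPal : Real.sqrt p * ΩW = ΩV) (hW : ΩW = uW * ΩfW) (hV : ΩV = uV * ΩfV)
    (huW : ‖(uW : ℚ_[p])‖ = 1) (huV : ‖(uV : ℚ_[p])‖ = 1) (hΩW : 0 < ΩW) :
    ‖(c₀ : ℚ_[p])‖ = 1 := by
  have huW0 : uW ≠ 0 := by rintro rfl; simp at huW
  have huV0 : uV ≠ 0 := by rintro rfl; simp at huV
  have hsqrt : ((Real.sqrt p : ℝ) : ℂ) ^ 2 = (p : ℂ) := by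
    rw [← Complex.ofReal_pow, Real.sq_sqrt (Nat.cast_nonneg p)]
    push_cast
    rfl
  -- `τ = ± √p`
  have hτpm : τ = (Real.sqrt p : ℂ) ∨ τ = -(Real.sqrt p : ℂ) := by
    have h0 : (τ + (Real.sqrt p : ℂ)) * (τ - (Real.sqrt p : ℂ)) = 0 := by
      rw [← sq_sub_sq, hτ, hsqrt, sub_self]
    rcases mul_eq_zero.mp h0 with h | h
    · exact Or.inr (eq_neg_of_add_eq_zero_left h)
    · exact Or.inl (sub_eq_zero.mp h)
  -- the period identities, in `ℂ`
  have e1 : (ΩW : ℂ) = ((uW : ℚ) : ℂ) * (ΩfW : ℂ) := by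
    have := congrArg (fun x : ℝ ↦ (x : ℂ)) hW
    push_cast at this
    exact this
  have e2 : (ΩV : ℂ) = ((uV : ℚ) : ℂ) * (ΩfV : ℂ) := by
    have := congrArg (fun x : ℝ ↦ (x : ℂ)) hV
    push_cast at this
    exact this
  have e3 : ((Real.sqrt p : ℝ) : ℂ) * (ΩW : ℂ) = (ΩV : ℂ) := by
    have := congrArg (fun x : ℝ ↦ (x : ℂ)) hPal
    push_cast at this
    exact this
  have hΩfW0 : (ΩfW : ℂ) ≠ 0 := by
    intro h
    rw [h, mul_zero] at e1
    exact (hΩW.ne') (by exact_mod_cast e1)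
  -- `c₀ τ u_V Ω⁺_{f_W} = √p u_W Ω⁺_{f_W}`, then cancel `Ω⁺_{f_W}`
  have key : ((c₀ : ℚ) : ℂ) * τ * ((uV : ℚ) : ℂ) * (ΩfW : ℂ) =
      ((Real.sqrt p : ℝ) : ℂ) * ((uW : ℚ) : ℂ) * (ΩfW : ℂ) := by
    linear_combination (((uV : ℚ) : ℂ)) * hrel - e2 - e3 + (((Real.sqrt p : ℝ) : ℂ)) * e1
  have key' : ((c₀ : ℚ) : ℂ) * τ * ((uV : ℚ) : ℂ) = ((Real.sqrt p : ℝ) : ℂ) * ((uW : ℚ) : ℂ) :=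
    mul_right_cancel₀ hΩfW0 key
  have hsqrt0 : ((Real.sqrt p : ℝ) : ℂ) ≠ 0 := by
    rw [Complex.ofReal_ne_zero]
    exact Real.sqrt_ne_zero'.mpr (by exact_mod_cast hp.out.pos)
  have huV0' : ((uV : ℚ) : ℂ) ≠ 0 := by exact_mod_cast huV0
  have hc : c₀ = uW / uV ∨ c₀ = -(uW / uV) := by
    rcases hτpm with h | h
    · left
      rw [h] at key'
      have : ((c₀ : ℚ) : ℂ) = ((uW / uV : ℚ) : ℂ) := by
        push_cast
        rw [eq_div_iff huV0']
        apply mul_left_cancel₀ hsqrt0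
        linear_combination key'
      exact_mod_cast this
    · right
      rw [h] at key'
      have h2 : ((c₀ : ℚ) : ℂ) * ((uV : ℚ) : ℂ) = -((uW : ℚ) : ℂ) := by
        apply mul_left_cancel₀ hsqrt0
        linear_combination -key'
      have : ((c₀ : ℚ) : ℂ) = ((-(uW / uV) : ℚ) : ℂ) := by
        push_cast
        field_simp
        linear_combination h2
      exact_mod_cast this
  rcases hc with h | h
  · rw [h]; push_cast; rw [norm_div, huW, huV, div_one]
  · rw [h]; push_cast; rw [norm_neg, norm_div, huW, huV, div_one]

/-! ### §4 The certificate of `W` from the `V`-side certificate data -/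

/-- **THE CERTIFICATE OF `W = V ⊗ χ_p` COMPUTED ON `V`, period bookkeeping discharged** (`p ≡ 1 mod 4`;
cells (G, e = 2) and (M) of class X4/X3: `V` good or multiplicative at `p`). Inputs: Pal 2012 Thm. 3.2
(`hPal`, named fact); `W ≅ V ⊗ χ_p` (`hVW`), `W` additive at `p`; the newforms `f_V`, `f_W` at levels
`N_V ∣ N_W`, `p² ∣ N_W`; the period transfers `Ω_W = u_W Ω⁺_{f_W}`, `Ω_V = u_V Ω⁺_{f_V}` with `p`-adic
units (the cell's Manin-type binders); `p`-integral plus symbols of `f_V`; the twist relation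
`a_q(W) ≡ (q/p) a_q(V)` at the Kolyvagin primes of `(W,p)`; and the `V`-SIDE CERTIFICATE DATA — `μ`
periodic, `T_q`-eigen with `a_q(V)` at those primes, `[r]⁺_{f_V} ≡ μ(r) − w μ(ℓr)` (computed per pair in the
mod-`p` plus modular symbols of level `N_V/ℓ`), `p ∤ ℓ`, `w·(ℓ/p) = 1`. Output:
`PlusSymbolLevelLowersAt W p f_W ℓ` — so every mod-`p` Kurihara number of `f_W` vanishes and `∂^{(∞)} ≥ 1`
(`X4/KuriharaLevelLowering`), and the BSD_p closures of `X4/KimDefectLevelLowering` apply to `W`.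
[cite: Pal2012, Thm. 3.2] [cite: Kim2022StructureSelmer, §1.2.2 and §1.4.3] [cite: MazurTateTeitelbaum1986Invent, §I.8] -/
theorem plusSymbolLevelLowersAt_of_twist_certificate
    (hPal : Pal2012.thm32_sqrt_mul_realPeriodRat_twist_eq_of_prime_one_mod_four) (hp4 : p % 4 = 1)
    (V W : WeierstrassCurve ℚ) [V.IsElliptic] [V.IsGloballyMinimal] [W.IsElliptic] [W.IsGloballyMinimal]
    (hVW : ∃ C : VariableChange ℚ, C • V.quadraticTwist (p : ℚ) = W) (hVred : Good V p ∨ Mult V p)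
    (hadd : Addv W p) {NV NW : ℕ} [NeZero NV] [NeZero NW] {fV : CuspForm (Gamma0 NV) 2}
    {fW : CuspForm (Gamma0 NW) 2} (hfV : IsNewformOf V fV) (hfW : IsNewformOf W fW) (hN : NV ∣ NW)
    (hm : p ^ 2 ∣ NW)
    (hperW : ∃ u : ℚ, ‖(u : ℚ_[p])‖ = 1 ∧ W.realPeriodRat = u * plusPeriod fW)
    (hperV : ∃ u : ℚ, ‖(u : ℚ_[p])‖ = 1 ∧ V.realPeriodRat = u * plusPeriod fV)
    (hint : ∀ x : ℚ, ¬ p ∣ (ratPlusSymbol fV x).den)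
    {μ : ℚ → ZMod p} (hμ : IsPeriodic μ) {w : ZMod p} {ℓ : ℕ} (hℓ : ¬ p ∣ ℓ)
    (hV : ∀ r : ℚ, ((ratPlusSymbol fV r : ℚ) : ZMod p) = μ r - w * μ (ℓ * r))
    (hw : w * ((legendreSym p (ℓ : ℤ) : ℤ) : ZMod p) = 1)
    (hHV : ∀ q : ℕ, Kato.IsKolyvaginPrime W p 1 q → HeckeRel μ q (V.frobeniusTrace q : ZMod p))
    (haq : ∀ q : ℕ, Kato.IsKolyvaginPrime W p 1 q →
      (W.frobeniusTrace q : ZMod p) = ((legendreSym p (q : ℤ) : ℤ) : ZMod p) * V.frobeniusTrace q) :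
    PlusSymbolLevelLowersAt W p fW ℓ := by
  haveI : NeZero p := ⟨hp.out.ne_zero⟩
  obtain ⟨c₀, hc₀, hrel⟩ := exists_rat_ratPlusSymbol_eq_legendreTwistSum p hp4 V W hVW hadd hfV hfW hN hm
  by_cases hex : ∃ r : ℚ,
      ∑ u : ZMod p, (legendreSym p (u.val : ℤ) : ℚ) * ratPlusSymbol fV (r + (u.val : ℚ) / p) ≠ 0
  · -- non-degenerate: `c₀` is a `p`-adic unit by the period relation
    obtain ⟨hχ1, hχq, _⟩ := jacobiChar_prime_ne_one_isQuadratic_isPrimitive p (show p ≠ 2 by omega)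
    have hχe := jacobiChar_even_of_mod_four_eq_one p hp4
    have hτ : gaussSum (jacobiChar p) (ZMod.stdAddChar (N := p)) ^ 2 = (p : ℂ) := by
      rw [gaussSum_sq hχ1 hχq (ZMod.isPrimitive_stdAddChar p), hχe, one_mul, ZMod.card]
    obtain ⟨uW, huW, hΩW⟩ := hperW
    obtain ⟨uV, huV, hΩV⟩ := hperV
    have hunit : ‖(c₀ : ℚ_[p])‖ = 1 :=
      norm_ratCast_eq_one_of_period_relation p hτ (hrel hex) (hPal V W p hp4 hVred hVW) hΩW hΩV huW huV
        W.realPeriodRat_pos_holds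
    have hc : ¬ p ∣ c₀.den := not_dvd_den_of_norm_ratCast_le_one hunit.le
    exact plusSymbolLevelLowersAt_of_legendreTwist W V fW fV c₀ hc hint hc₀ hμ hℓ hV hw hHV haq
  · -- degenerate: the plus symbol of `f_W` vanishes identically; the certificate is trivial
    simp only [not_exists, not_not] at hex
    refine ⟨0, fun _ _ ↦ rfl, fun q _ r ↦ by simp, fun r ↦ ?_⟩
    rw [hc₀ r, hex r, mul_zero, Rat.cast_zero, Pi.zero_apply, Pi.zero_apply, sub_zero]

end Summit.BirchSwinnertonDyer.Rank1Residual.Additive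

end
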